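import Mathlib.Data.ENNReal.Basic
import HarnessLib

/-!
# Crux `ModePriceIntegrable` (stmt-AtomisticToContinuum-18512), line `Sketch`, stub P
# `stub_price_of_softenedOccupation` — the price from a bounded softened occupation (the chord)

Supports (does not close) stmt-AtomisticToContinuum-18512.

Abstract variational step, all in `ℝ≥0∞` and written additively (no truncated subtraction): if for
every `δ > 0` the softened functional `F - s·n` has a `δ`-near-minimiser `Φ_δ`
(`∀ Ψ, F Φ_δ + s n Ψ ≤ F Ψ + s n Φ_δ + δ`) whose softened occupation is bounded, `s n Φ_δ ≤ B`,
then the single-mode price holds: `inf F + s n Ψ ≤ F Ψ + B` for every `Ψ`.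

Proof: fix `Ψ`; by `ENNReal.le_of_forall_pos_le_add` it suffices to show
`inf F + s n Ψ ≤ F Ψ + B + ε` for every real `ε > 0`; with `δ := ε` and the corresponding `Φ`,
`inf F + s n Ψ ≤ F Φ + s n Ψ ≤ F Ψ + s n Φ + ε ≤ F Ψ + B + ε` (`iInf_le`, the near-minimiser
property at `Ψ`, the occupation bound). [folklore]
-/

namespace Summit.AtomisticToContinuum.BoseEinsteinCondensation.Theorems

/-- **Stub P — the price from a bounded softened occupation** (the chord): if for every `δ > 0` the
softened functional `F - s·n` (written additively) has a `δ`-near-minimiser `Φ_δ` with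
`s·n(Φ_δ) ≤ B`, then `inf F + s·n(Ψ) ≤ F(Ψ) + B` for every `Ψ`
(`inf F + s n(Ψ) ≤ F(Φ_δ) + s n(Ψ) ≤ F(Ψ) + s n(Φ_δ) + δ ≤ F(Ψ) + B + δ`, `δ ↓ 0`). [folklore] -/
theorem stub_price_of_softenedOccupation : ∀ {S : Type} (F n : S → ENNReal) (s B : ENNReal), (∀ δ : ENNReal, 0 < δ → ∃ Φ, (∀ Ψ, F Φ + s * n Ψ ≤ F Ψ + s * n Φ + δ) ∧ s * n Φ ≤ B) → ∀ Ψ, (⨅ Φ, F Φ) + s * n Ψ ≤ F Ψ + B := by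
  intro S F n s B h Ψ
  refine ENNReal.le_of_forall_pos_le_add fun ε hε _ => ?_
  obtain ⟨Φ, hΦ, hB⟩ := h ε (ENNReal.coe_pos.2 hε)
  calc (⨅ Φ, F Φ) + s * n Ψ ≤ F Φ + s * n Ψ := add_le_add (iInf_le F Φ) le_rfl
    _ ≤ F Ψ + s * n Φ + ε := hΦ Ψ
    _ ≤ F Ψ + B + ε := add_le_add (add_le_add le_rfl hB) le_rfl

end Summit.AtomisticToContinuum.BoseEinsteinCondensation.Theorems
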